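import Literature.NumberTheory.PAdicHodge.CrystallineBaseChange
import HarnessLib

/-!
# Labelled Hodge–Tate weights under finite base change, LABEL BY LABEL:
# `HT_{τ''}(ρ|_{Γ_L}) = HT_{τ''|_K}(ρ)` for THE pinned Fontaine data

Topic `Literature/NumberTheory/PAdicHodge` (pattern and binders of the accepted sibling
`Literature.NumberTheory.PAdicHodge.LabelledHodgeTateWeightsBaseChange` of file `CrystallineBaseChange`,
which is the special case "every label has the same multiset `S`" of the statement below; vocabulary:
`fontainePst` (`FontaineDpst`), `PeriodRingData.labelledHodgeTateWeights` (`LabelledHodgeTateWeights`),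
`FramedRep`, `FramedRep.comp`, `absGaloisRestrict` (`AbsGaloisRestrict`), and for the global corollary
`fontainePstAdicCompletion`, `FramedGaloisRep.labelledHodgeTateWeightsAt`, `FramedGaloisRep.restrictField`,
`adicCompletionOfLiesOver` (`AdeleBaseChange`), `exists_toLocal_restrictField_eq_conj`
(`ToLocalRestrictField`)).

O. Brinon, B. Conrad, *CMI Summer School notes on `p`-adic Hodge theory* (2009), **Prop. 6.3.8**
(p. 92 of the Stanford text): "For any complete discretely-valued extension `K'/K` inside of `ℂ_K`
and any `V ∈ Rep_{ℚ_p}(G_K)`, the natural map `K' ⊗_K D_{dR,K}(V) → D_{dR,K'}(V)` is an isomorphism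
in `Fil_{K'}`" — so `gr^i` commutes with the finite base change `K'/K`, and splitting
`K' ⊗_K D_{dR,K}(V) ⊗_{ℚ_p} ℚ̄_p = ⊕_{τ'' : K' → ℚ̄_p} e_{τ''}(…)` one gets, label by label,
`HT_{τ''}(V|_{G_{K'}}) = HT_{τ''|_K}(V)` for every `ℚ_p`-embedding `τ'' : K' → ℚ̄_p`
(Patrikis 2019, §2.7.1: "`HT_{τ'}(ρ|_{Γ_{F'}}) = HT_{τ'|_F}(ρ)`"; the docstring of the accepted
`LabelledHodgeTateWeights`, "What is NOT here", records this invariance as a wanted theorem).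

## What is vendored

NAMED FACT (D-0014) `LabelledHodgeTateWeightsBaseChangeLabelwise`: for a continuous embedding
`K → L` of characteristic-`0` non-archimedean local fields of residue characteristic `ℓ`
(`hK : |ℓ|_K < 1`, `hL : |ℓ|_L < 1`), a framed `ρ : Γ_K →ₜ* GL_n(ℚ̄_ℓ)` and a label
`τ'' : L →ₐ[ℚ_ℓ] ℚ̄_ℓ` for the `ℚ_ℓ`-structure of `fontainePst L ℓ hL` (the canonical one,
`fontainePst_algebra_eq_padicAlgebra`), the `τ''`-labelled Hodge–Tate multiset of
`ρ ∘ absGaloisRestrict K L` relative to `(fontainePst L ℓ hL).𝔅 = B_dR(L)` equals the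
`(τ'' ∘ (K → L))`-labelled multiset of `ρ` relative to `(fontainePst K ℓ hK).𝔅 = B_dR(K)` (the
restricted label as a bare ring homomorphism `K →+* ℚ̄_ℓ`, which is how
`PeriodRingData.labelledHodgeTateWeights` is indexed).  Exactly as for the sibling, the period rings
ARE the constructions `bdRPeriodRingData` (clause (F9), unconditionally), so discharging this is the
transport of the tree's `B_dR(L)` to `B_dR(K)` along `\widehat{K̄} ≅ \widehat{L̄}` followed by
Prop. 6.3.8 — the not-yet-formalised functoriality recorded on `DeRhamBaseChange`.  The sibling
`LabelledHodgeTateWeightsBaseChange` is its corollary (`labelledHodgeTateWeightsBaseChange_of_labelwise`,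
proved here).  Requested by crux `stmt-Langlands-17009` (`NonParallelVoid.TensorSquareParallel`, stub
`stub_ordinaryDihedralVoid`: the labelled weights of `ρ|_{Γ_{K'}} ≅ r_ι(π)` over a CM extension `K'/F`
must be compared with those of `ρ` label by label — two labels of `F` with DIFFERENT multisets — so
the uniform-`S` sibling does not suffice).
-- TODO(general form): the filtered isomorphism `K' ⊗_K D_{dR,K}(V) ≅ D_{dR,K'}(V)` itself, for every complete discretely-valued `K'/K ⊆ ℂ_K`.

## Global corollary (proved)

`labelledHodgeTateWeightsAt_restrictField_eq_comp_of_liesOver`: for number fields `F ⊆ E`, places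
`w ∣ v ∣ ℓ` and `τ'' : E_w →ₐ[ℚ_ℓ] ℚ̄_ℓ` (pinned structure),
`HT_{τ''}((ρ|_{Γ_E})|_{Γ_{E_w}}) = HT_{τ'' ∘ (F_v → E_w)}(ρ|_{Γ_{F_v}})` for the summit's data
`fontainePstAdicCompletion` — the local fact along the continuous `F_v → E_w`
(`adicCompletionOfLiesOver`) plus the change of frame `exists_toLocal_restrictField_eq_conj`
(pattern of the accepted `labelledHodgeTateWeightsAt_restrictField_eq_of_liesOver`).

## References

* [BrinonConrad2009] O. Brinon, B. Conrad, *CMI Summer School notes on p-adic Hodge theory* (2009),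
  Prop. 6.3.8.
* [Patrikis2019] S. Patrikis, *Variations on a theorem of Tate*, Mem. AMS 258 (2019), §2.7.1.
* [FontaineAsterisque223III] J.-M. Fontaine, *Représentations p-adiques semi-stables*, Astérisque 223
  (1994), Exp. III §1.5, §3.
-/

noncomputable section

open Field IsDedekindDomain ValuativeRel NumberField
open scoped NumberField
open Literature.NumberTheory.GaloisRepresentations Literature.NumberTheory.Automorphic

namespace Literature.NumberTheory.PAdicHodge

/-- **The labelled Hodge–Tate weights for THE pinned Fontaine data are insensitive to a finite
extension of the `ℓ`-adic base field, label by label** (Brinon–Conrad 2009, Prop. 6.3.8: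
`K' ⊗_K D_{dR,K}(V) ≅ D_{dR,K'}(V)` in `Fil_{K'}`, whence `HT_{τ''}(V|_{Γ_L}) = HT_{τ''|_K}(V)`;
Patrikis 2019, §2.7.1), tree form for THE pinned data (NAMED FACT, D-0014): for a continuous embedding
`K → L` of characteristic-`0` non-archimedean local fields of residue characteristic `ℓ`, a framed
`ρ : Γ_K →ₜ* GL_n(ℚ̄_ℓ)` and a label `τ'' : L →ₐ[ℚ_ℓ] ℚ̄_ℓ` for the `ℚ_ℓ`-structure of
`fontainePst L ℓ hL`, the `τ''`-labelled Hodge–Tate multiset of `ρ ∘ absGaloisRestrict K L` relative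
to `B_dR(L)` is the `(τ'' ∘ (K → L))`-labelled multiset of `ρ` relative to `B_dR(K)`.
[cite: BrinonConrad2009, Prop. 6.3.8] [cite: Patrikis2019, §2.7.1]
[cite: FontaineAsterisque223III, Exp. III §1.5 and §3] -/
def LabelledHodgeTateWeightsBaseChangeLabelwise : Prop :=
  ∀ (ℓ : ℕ) [Fact ℓ.Prime] (K L : Type) [Field K] [ValuativeRel K] [TopologicalSpace K]
    [IsNonarchimedeanLocalField K] [CharZero K] [Field L] [ValuativeRel L] [TopologicalSpace L]
    [IsNonarchimedeanLocalField L] [CharZero L] [Algebra K L], Continuous (algebraMap K L) →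
    ∀ (hK : valuation K (ℓ : K) < 1) (hL : valuation L (ℓ : L) < 1) (n : ℕ)
      (ρ : FramedRep (absoluteGaloisGroup K) (PadicAlgCl ℓ) n),
      letI := (fontainePst L ℓ hL).algebra
      ∀ τ'' : L →ₐ[ℚ_[ℓ]] PadicAlgCl ℓ,
        (fontainePst L ℓ hL).𝔅.labelledHodgeTateWeights
            (FramedRep.toContinuousRep (ρ.comp (absGaloisRestrict K L))) τ''.toRingHom =
          (letI := (fontainePst K ℓ hK).algebra
           (fontainePst K ℓ hK).𝔅.labelledHodgeTateWeights (FramedRep.toContinuousRep ρ)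
             (τ''.toRingHom.comp (algebraMap K L)))

/-- **The uniform-multiset sibling follows**: if every label of `K` has multiset `S`, so does every
label of `L` after restriction (each restricted label `τ'' ∘ (K → L)` is a `ℚ_ℓ`-algebra embedding of
`K` for the pinned structure as soon as the two pinned `ℚ_ℓ`-structures are compatible with `K → L`,
which is the extra hypothesis `hcomp`; both structures are the canonical ones,
`fontainePst_algebra_eq_padicAlgebra`). [cite: BrinonConrad2009, Prop. 6.3.8] -/
theorem labelledHodgeTateWeights_eq_of_forall_of_labelwise (h : LabelledHodgeTateWeightsBaseChangeLabelwise)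
    {ℓ : ℕ} [Fact ℓ.Prime] {K L : Type} [Field K] [ValuativeRel K] [TopologicalSpace K]
    [IsNonarchimedeanLocalField K] [CharZero K] [Field L] [ValuativeRel L] [TopologicalSpace L]
    [IsNonarchimedeanLocalField L] [CharZero L] [Algebra K L] (hc : Continuous (algebraMap K L))
    (hK : valuation K (ℓ : K) < 1) (hL : valuation L (ℓ : L) < 1) {n : ℕ}
    (ρ : FramedRep (absoluteGaloisGroup K) (PadicAlgCl ℓ) n) (S : Multiset ℤ)
    (hcomp : ∀ q : ℚ_[ℓ], algebraMap K L ((fontainePst K ℓ hK).algebra.algebraMap q) =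
      (fontainePst L ℓ hL).algebra.algebraMap q)
    (hS : letI := (fontainePst K ℓ hK).algebra
      ∀ τ' : K →ₐ[ℚ_[ℓ]] PadicAlgCl ℓ,
        (fontainePst K ℓ hK).𝔅.labelledHodgeTateWeights (FramedRep.toContinuousRep ρ) τ'.toRingHom = S) :
    letI := (fontainePst L ℓ hL).algebra
    ∀ τ'' : L →ₐ[ℚ_[ℓ]] PadicAlgCl ℓ,
      (fontainePst L ℓ hL).𝔅.labelledHodgeTateWeights
        (FramedRep.toContinuousRep (ρ.comp (absGaloisRestrict K L))) τ''.toRingHom = S := by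
  letI := (fontainePst L ℓ hL).algebra
  intro τ''
  rw [h ℓ K L hc hK hL n ρ τ'']
  letI := (fontainePst K ℓ hK).algebra
  -- the restricted label is a `ℚ_ℓ`-algebra embedding of `K` for the pinned structure
  let τ' : K →ₐ[ℚ_[ℓ]] PadicAlgCl ℓ :=
    { (τ''.toRingHom.comp (algebraMap K L)) with
      commutes' := fun q => by
        change τ'' (algebraMap K L (algebraMap ℚ_[ℓ] K q)) = algebraMap ℚ_[ℓ] (PadicAlgCl ℓ) q
        have : algebraMap K L (algebraMap ℚ_[ℓ] K q) = algebraMap ℚ_[ℓ] L q := hcomp q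
        rw [this, AlgHom.commutes] }
  exact hS τ'

section Global

variable {F E : Type} [Field F] [NumberField F] [Field E] [NumberField E] [Algebra F E]
  {ℓ : ℕ} [Fact ℓ.Prime] {n : ℕ}

/-- **Label-by-label base change of the labelled Hodge–Tate weights of the summit's pinned data,
place by place**: for `w ∣ v ∣ ℓ` and a label `τ''` of `E_w`,
`HT_{τ''}((ρ|_{Γ_E})|_{Γ_{E_w}}) = HT_{τ'' ∘ (F_v → E_w)}(ρ|_{Γ_{F_v}})` — the local fact along the
continuous `F_v → E_w` (`adicCompletionOfLiesOver`), then the change of frame `ρ(τ)`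
(`exists_toLocal_restrictField_eq_conj`, `PstWeilDeligneData.labelledHodgeTateWeights_conj_eq`).
[cite: BrinonConrad2009, Prop. 6.3.8] [cite: SerreAbelianLadic1968, Ch. I §2.1] -/
theorem labelledHodgeTateWeightsAt_restrictField_eq_comp_of_liesOver
    (h : LabelledHodgeTateWeightsBaseChangeLabelwise)
    (ρ : FramedGaloisRep F (PadicAlgCl ℓ) n) (v : HeightOneSpectrum (𝓞 F))
    (w : HeightOneSpectrum (𝓞 E)) [w.asIdeal.LiesOver v.asIdeal] (hv : ((ℓ : ℕ) : 𝓞 F) ∈ v.asIdeal)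
    (hw : ((ℓ : ℕ) : 𝓞 E) ∈ w.asIdeal) :
    letI := (fontainePstAdicCompletion w ℓ hw).algebra
    ∀ τ'' : w.adicCompletion E →ₐ[ℚ_[ℓ]] PadicAlgCl ℓ,
      (ρ.restrictField E).labelledHodgeTateWeightsAt w (fontainePstAdicCompletion w ℓ hw).algebra
          (fontainePstAdicCompletion w ℓ hw).𝔅 τ''.toRingHom =
        ρ.labelledHodgeTateWeightsAt v (fontainePstAdicCompletion v ℓ hv).algebra
          (fontainePstAdicCompletion v ℓ hv).𝔅
          (τ''.toRingHom.comp (adicCompletionOfLiesOver F E v w)) := by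
  letI := (adicCompletionOfLiesOver F E v w).toAlgebra
  haveI := LocalField.charZero_adicCompletion v
  haveI := LocalField.charZero_adicCompletion w
  letI := (fontainePstAdicCompletion w ℓ hw).algebra
  intro τ''
  obtain ⟨τ, hτ⟩ := exists_toLocal_restrictField_eq_conj ρ v w
  have key := h ℓ (v.adicCompletion F) (w.adicCompletion E)
    (continuous_adicCompletionOfLiesOver F E v w)
    (LocalField.valuation_adicCompletion_natCast_lt_one v ℓ hv)
    (LocalField.valuation_adicCompletion_natCast_lt_one w ℓ hw) n (ρ.toLocal v) τ''
  calc (ρ.restrictField E).labelledHodgeTateWeightsAt w (fontainePstAdicCompletion w ℓ hw).algebra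
          (fontainePstAdicCompletion w ℓ hw).𝔅 τ''.toRingHom
      = (letI := (fontainePstAdicCompletion w ℓ hw).algebra
         (fontainePstAdicCompletion w ℓ hw).𝔅.labelledHodgeTateWeights
           (FramedRep.toContinuousRep ((ρ.toLocal v).comp
             (absGaloisRestrict (v.adicCompletion F) (w.adicCompletion E)))) τ''.toRingHom) := by
        rw [FramedGaloisRep.labelledHodgeTateWeightsAt_def, hτ]
        exact PstWeilDeligneData.labelledHodgeTateWeights_conj_eq _ (ρ τ) _ τ''.toRingHom
    _ = _ := key

end Global

end Literature.NumberTheory.PAdicHodge
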